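import Summits.BirchSwinnertonDyer.BirchSwinnertonDyer.Theses.EisensteinPrimes
import Summits.BirchSwinnertonDyer.BirchSwinnertonDyer.Theorems.EisensteinPrimesBSDpOnCellCReorientedPointwise
import Summits.BirchSwinnertonDyer.BirchSwinnertonDyer.Theorems.EisensteinPrimesBSDpOnCellCReorientedPNew
import Literature.NumberTheory.EllipticCurves.SteinWuthrich2013.SplitMultCanonicalHolds
import Literature.NumberTheory.EllipticCurves.SteinWuthrich2013.NonsplitMultCanonicalHolds
import Literature.NumberTheory.GaloisRepresentations.NumberFieldCdTwoProofs
import Literature.NumberTheory.EllipticCurves.HeegnerPointsRationalityProofs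
import Literature.NumberTheory.EllipticCurves.AnticyclotomicPrimeDecompositionSplitProofs
import Literature.NumberTheory.EllipticCurves.ManinConstantDeuringTwistProofs
import Literature.NumberTheory.Automorphic.ShimuraCurveRibetTakahashiOptimalProofs
import Summits.BirchSwinnertonDyer.Rank1Residual.X11b.LocalPrimaryCohomologyEP
import HarnessLib

/-!
# Crux 4 `BSDpOnCellC` from line b1's FOUR stubs of skeleton v9 — `stub_publishedFacts` (16 PUB facts +
# [cas-split]), `stub_c2` (value at `p = 3`, both signs), the RE-ORIENTED `stub_c3′` (c3♭′ ∧ c3s♭′ =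
# `X2.NonsplitIMCEqOnTreeIntOther` ∧ `X2.SplitIMCEqOnTreeIntOther`, X-slot at `𝔭̄` — RULING L31 (R1)) and
# `stub_mazurMC_cellB` (crux 3 verbatim) — the composition `bsdpOnCellC_of_stubs_reoriented` (cell
# `bsd-eis`, seat `bsd-eis-cgshw` g12; twin of cgshw g9's `bsdpOnCellC_of_stubs_of_pNewValue_bothSigns`,
# p438601, on the re-threaded roads)

HONEST FRAMING (cell `bsd-eis`, run/shared/lean/pub/bsd-eis/): theorems only; nothing booked; X2 stays
CONSTRUCTION-SHAPED; no label or count moves; BSD is not proved by any of this — a closed crux 4 would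
close the B11 leaf of rung K5 only, and every road here is CONDITIONAL on the four stubs (the value atom at
`3 ‖ N` is NOT in print; the IMC atom is Keller–Yin Thm. D, PREPRINT with the L1754 gap; crux 3 is OPEN).

* `bsdp_of_cellC_of_not_split_of_manin_of_pNewValue_of_imcIntOther` — the `p ≥ 5` non-split pointwise
  theorem of `…ReorientedPNew.lean` with the partner supplied by parity cases (X2a CLOSED by
  `targetA_of_published`; X2b ∩ {non-split} = Mazur's MC input).
* **`bsdpOnCellC_of_stubs_reoriented`** — hypotheses = the four v9 stub signatures VERBATIM; conclusion =
  the route decl `Summit.BirchSwinnertonDyer.BirchSwinnertonDyer.Theses.EisensteinPrimes.BSDpOnCellC` BY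
  NAME. Proof: the EIGHT proved published inputs are supplied by name (Stein–Wuthrich 2013 §4.2 canonical
  heights ×2, `cd ≤ 2`, Heegner-point rationality, modular parametrisation data ⇐ newform existence,
  Tate's local Euler–Poincaré characteristic, Brink's decomposition law, Edixhoven's integrality); the
  Manin condition is moved to the `X₀(N)`-optimal curve (`X2.bsdp_of_cellC_of_forall_isIsogenous`: Mazur
  1978 Cor. 4.1, Edixhoven, Cassels); case split sign × (`5 ≤ p` / `p = 3`, the only odd prime below `5`):
  `p ≥ 5` → the two `…pNewValue_of_imcIntOther…` theorems (value half FROM PRINT); `p = 3` → the two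
  `…manin_of_intResidualsOther` theorems with the typed value input; CTL-split is the THEOREM
  `Theorems.CtlLoc.splitControlOnTree_of_cellC` inside the split roads (no «CTL ∨ switch» stub).

References: [Castella2018Exceptional] Thms. 2.10–2.11; [Castella2018] Thm. 2.3, Thm. 3.2, §5; [Hsieh2014]
Thm. 1; [KellerYin2024] Thm. D (PRE); [CastellaEtAl2021] Thm. 5.3.1; [Mazur1978] Cor. 4.1; [MilneADT2006]
I.7.3; [Miller2011LMS] Def. 1.1; RULINGS L5 / L11 (O2) / L15 / L29 / L31.
-/

set_option autoImplicit false
set_option linter.dupNamespace false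

noncomputable section

open scoped Classical MatrixGroups ModularForm

open CongruenceSubgroup WeierstrassCurve NumberField IsDedekindDomain Field PowerSeries
  Literature.NumberTheory.EllipticCurves Literature.NumberTheory.EllipticCurves.GreenbergSelmer
  Literature.NumberTheory.EllipticCurves.ModularForms Literature.NumberTheory.QuadraticFields
  Literature.NumberTheory.EllipticCurves.Rank1Residual
  Literature.NumberTheory.EllipticCurves.Rank1Residual.Typed
  Literature.NumberTheory.EllipticCurves.KrizLi2019
  Literature.NumberTheory.EllipticCurves.GreenbergVatsal2000
  Literature.NumberTheory.EllipticCurves.Wuthrich2014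
  Literature.NumberTheory.EllipticCurves.SteinWuthrich2013
  Literature.NumberTheory.EllipticCurves.Castella2018Exceptional
  Literature.NumberTheory.GaloisRepresentations Literature.NumberTheory.GaloisCohomology
  Literature.NumberTheory.Automorphic
  Summit.BirchSwinnertonDyer.Rank1Residual.X11b.AcSelmer
  Summit.BirchSwinnertonDyer.Rank1Residual.X11b.Halves
  Summit.BirchSwinnertonDyer.Rank1Residual.X11b
  Summit.BirchSwinnertonDyer.Rank1Residual.X2
  Summit.BirchSwinnertonDyer.Rank1Residual

namespace Summit.BirchSwinnertonDyer.BirchSwinnertonDyer.Theorems.Reoriented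

/-! ### The `p ≥ 5` non-split pointwise theorem with the partner by parity cases -/

section Pointwise

variable (W : WeierstrassCurve ℚ) [W.IsElliptic] [W.IsGloballyMinimal] (p : ℕ) [Fact p.Prime]

/-- **X2c ∩ {non-split}, `p ≥ 5`, pointwise with a Manin datum, parity-cases form, IMC atom RE-ORIENTED.**
`bsdp_of_cellC_of_not_split_of_manin_of_pNewValue_of_imcIntOther_of_partner` with the partner's
rank-zero `p`-part by cases on its Greenberg–Vatsal parity (X2a CLOSED, `targetA_of_published`;
X2b ∩ {non-split} = the input `hMCB`, the twist being X2 and non-split at `p` by `classX2_twist` /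
`not_hasSplitMultiplicativeReductionAtPrime_of_smul_eq_quadraticTwist`). CONDITIONAL on every listed
binder; nothing booked. [cite: Castella2018Exceptional, Thm. 2.10 and Thm. 2.11 (arXiv:1507.04260 pp. 13–14)]
[cite: GreenbergVatsal2000, Thm. (1.3)] [claim: KellerYin2024, status: under-review] [cite: Miller2011LMS, Def. 1.1] -/
theorem bsdp_of_cellC_of_not_split_of_manin_of_pNewValue_of_imcIntOther
    (hGV : lambdaMu_multiplicative_of_gvPar) (hWu : thm16_charIdeal_dvd_multiplicative_of_reducible)
    (hJs : thm61_splitMultiplicative) (hJn : thm61_nonsplitMultiplicative)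
    (hHs : exists_isSplitMultCanonical) (hHn : exists_isMultCanonical)
    (hpar : nonempty_modularParametrizationData)
    (hGS : ∀ (W : WeierstrassCurve ℚ) [W.IsElliptic] [W.IsGloballyMinimal] (p : ℕ) [Fact p.Prime],
      greenberg_stevens (W := W) (p := p))
    (hnf : exists_isNewformOf)
    (hPT : ∀ (K : Type) [Field K] [NumberField K], poitouTate_selmerStructure_duality K)
    (hPT2 : ∀ (K : Type) [Field K] [NumberField K], poitouTate_sha_tateDual K)
    (hEP : ∀ (K : Type) [Field K] [NumberField K] (v : HeightOneSpectrum (𝓞 K)),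
      localEulerPoincareCharacteristic (v.adicCompletion K))
    (hcd : fieldCdLE_two_of_numberField)
    (hBr : ∀ (K : Type) [Field K] [NumberField K] (p : ℕ) [Fact p.Prime],
      ZpExtension.decomp_not_le_kerSubgroup_of_isAnticyclotomic K p)
    (hH : hsieh2014_exists_anticyclotomicPAdicLFunction)
    (hCS : thm210_thm211_bdpDisplay_pNew)
    (hGZ : ∀ (N : ℕ) [NeZero N] (W : WeierstrassCurve ℚ) (K : Type) [Field K] [NumberField K],
      gross_zagier N W K)
    (hKo : ∀ (N : ℕ) [NeZero N] (W : WeierstrassCurve ℚ) (K : Type) [Field K] [NumberField K],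
      kolyvagin N W K)
    (hHP : ∀ (N : ℕ) [NeZero N] (W : WeierstrassCurve ℚ) (K : Type) [Field K] [NumberField K],
      heegnerPointComplex_mem_range_map N W K)
    (hGZK : rank_eq_analyticRank_of_analyticRank_le_one)
    (hHL : HoffsteinLuo1997_exists_twist_L_one_ne_zero)
    (hp5 : 5 ≤ p) (hc : CellC W p) (hns : ¬ W.HasSplitMultiplicativeReductionAtPrime p)
    (hMan : HasPrimeToManinDatum W p) (h3 : NonsplitIMCEqOnTreeIntOther W p)
    (hMCB : ∀ (W' : WeierstrassCurve ℚ) [W'.IsElliptic] [W'.IsGloballyMinimal],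
      CellB W' p → ¬ W'.HasSplitMultiplicativeReductionAtPrime p → MazurMainConjectureAt W' p) :
    BSDp W p := by
  have hmod : hasEntireLFunction_rat := WeierstrassCurve.hasEntireLFunction_rat_of_exists_isNewformOf hnf
  refine bsdp_of_cellC_of_not_split_of_manin_of_pNewValue_of_imcIntOther_of_partner W p hnf hPT hPT2
    hEP hcd hBr hH hCS hGZ hKo hHP hGZK hHL hp5 hc hns hMan h3 ?_
  intro K _ _ hK _ _ _ hHp _ Wd _ _ hWd hrd
  obtain ⟨C, hC⟩ := hWd
  have hXd : ClassX2 Wd p := classX2_twist W p hc.2 K hK hHp Wd ⟨C, hC⟩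
  have hnsd : ¬ Wd.HasSplitMultiplicativeReductionAtPrime p :=
    not_hasSplitMultiplicativeReductionAtPrime_of_smul_eq_quadraticTwist W Wd hK p hc.2.1 hc.2.2.2
      hns hHp hC
  have hbsdd : BSDp Wd p := by
    by_cases hgv : GVPar Wd p
    · exact targetA_of_published hGV hWu hJs hJn hHs hHn hGZK hmod hpar hGS Wd p ⟨hrd, hXd, hgv⟩
    · exact bsdp_of_mazurMainConjectureAt_of_analyticRank_eq_zero hJs hJn hHs hHn hGZK hmod hpar Wd p
        (hGS Wd p) hXd.1 hXd.2.2 hrd (hMCB Wd ⟨hrd, hXd, hgv⟩ hnsd)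
  exact pPartRankZero_of_pPart hGZK Wd p hrd (pPart_of_bsdp hmod hGZK Wd p (by omega) hbsdd)

end Pointwise

/-! ### The composition from the four v9 stubs -/

section Composition

/-- **Crux 4 `BSDpOnCellC` from line b1's four v9 stubs.** Hypotheses VERBATIM the registered signatures:
`hPub` = `stub_publishedFacts` (16 published inputs as one conjunction — GV 2000 λ/μ, Wuthrich 2014
Thm. 16, Stein–Wuthrich 2013 Thm. 6.1 ×2, Greenberg–Stevens, newform existence, Poitou–Tate ×2, Hsieh 2014
Thm. 1, Gross–Zagier, Kolyvagin, GZK rank, Hoffstein–Luo, Mazur 1978 on the Manin constant, Cassels — and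
[cas-split] `thm210_thm211_bdpDisplay_pNew`); `h2` = `stub_c2` (c2♭ / c2s♭ at `p = 3` ONLY); `h3` =
`stub_c3′` (the RE-ORIENTED IMC atoms `X2.NonsplitIMCEqOnTreeIntOther` / `X2.SplitIMCEqOnTreeIntOther` at
every CellC pair of the sign); `hMCB` = the route decl `MazurMCOnCellB` (crux 3). Conclusion: the route
decl `BSDpOnCellC` (= `X2.TargetC`) BY NAME. Proof: module docstring. CONDITIONAL on every listed binder;
nothing booked; X2 CONSTRUCTION-SHAPED; no label change.
[cite: Castella2018Exceptional, Thm. 2.10 and Thm. 2.11 (arXiv:1507.04260 pp. 13–14)]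
[cite: Hsieh2014, Thm. 1 (arXiv:1112.1580 pp. 3–4)] [claim: KellerYin2024, status: under-review]
[cite: CastellaEtAl2021, Thm. 5.3.1] [cite: Mazur1978, Cor. 4.1] [cite: MilneADT2006, Thm. I.7.3]
[cite: Castella2018, Thm. 2.3 (arXiv:1704.06608 p. 5)] [cite: Miller2011LMS, Def. 1.1] -/
theorem bsdpOnCellC_of_stubs_reoriented
    (hPub : (lambdaMu_multiplicative_of_gvPar ∧ thm16_charIdeal_dvd_multiplicative_of_reducible ∧
      thm61_splitMultiplicative ∧ thm61_nonsplitMultiplicative ∧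
      (∀ (W : WeierstrassCurve ℚ) [W.IsElliptic] [W.IsGloballyMinimal] (p : ℕ) [Fact p.Prime],
        greenberg_stevens (W := W) (p := p)) ∧
      exists_isNewformOf ∧
      (∀ (K : Type) [Field K] [NumberField K], poitouTate_selmerStructure_duality K) ∧
      (∀ (K : Type) [Field K] [NumberField K], poitouTate_sha_tateDual K) ∧
      hsieh2014_exists_anticyclotomicPAdicLFunction ∧
      (∀ (N : ℕ) [NeZero N] (W : WeierstrassCurve ℚ) (K : Type) [Field K] [NumberField K],
        gross_zagier N W K) ∧
      (∀ (N : ℕ) [NeZero N] (W : WeierstrassCurve ℚ) (K : Type) [Field K] [NumberField K],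
        kolyvagin N W K) ∧
      rank_eq_analyticRank_of_analyticRank_le_one ∧ HoffsteinLuo1997_exists_twist_L_one_ne_zero ∧
      mazur_not_dvd_maninConstant_of_odd ∧ bsdRHS_eq_of_isIsogenous) ∧
      thm210_thm211_bdpDisplay_pNew)
    (h2 : (∀ (W : WeierstrassCurve ℚ) [W.IsElliptic] [W.IsGloballyMinimal] (p : ℕ) [Fact p.Prime],
        p = 3 → CellC W p → ¬ W.HasSplitMultiplicativeReductionAtPrime p → NonsplitBDPValueOnTreeInt W p) ∧
      (∀ (W : WeierstrassCurve ℚ) [W.IsElliptic] [W.IsGloballyMinimal] (p : ℕ) [Fact p.Prime],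
        p = 3 → CellC W p → W.HasSplitMultiplicativeReductionAtPrime p → SplitBDPValueOnTreeInt W p))
    (h3 : (∀ (W : WeierstrassCurve ℚ) [W.IsElliptic] [W.IsGloballyMinimal] (p : ℕ) [Fact p.Prime],
        CellC W p → ¬ W.HasSplitMultiplicativeReductionAtPrime p → NonsplitIMCEqOnTreeIntOther W p) ∧
      (∀ (W : WeierstrassCurve ℚ) [W.IsElliptic] [W.IsGloballyMinimal] (p : ℕ) [Fact p.Prime],
        CellC W p → W.HasSplitMultiplicativeReductionAtPrime p → SplitIMCEqOnTreeIntOther W p))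
    (hMCB : Summit.BirchSwinnertonDyer.BirchSwinnertonDyer.Theses.EisensteinPrimes.MazurMCOnCellB) :
    Summit.BirchSwinnertonDyer.BirchSwinnertonDyer.Theses.EisensteinPrimes.BSDpOnCellC := by
  obtain ⟨⟨hGV, hWu, hJs, hJn, hGS, hnf, hPT, hPT2, hH, hGZ, hKo, hGZK, hHL, hMaz, hCassels⟩, hCS⟩ :=
    hPub
  obtain ⟨h2three, h2sthree⟩ := h2
  obtain ⟨h3n, h3s⟩ := h3
  -- the eight PROVED published inputs, by name
  have hHs : exists_isSplitMultCanonical := SteinWuthrich2013.exists_isSplitMultCanonical_holds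
  have hHn : exists_isMultCanonical := SteinWuthrich2013.exists_isMultCanonical_holds
  have hpar : nonempty_modularParametrizationData :=
    nonempty_modularParametrizationData_iff_exists_isNewformOf_unconditional.mpr hnf
  have hEP : ∀ (K : Type) [Field K] [NumberField K] (v : HeightOneSpectrum (𝓞 K)),
      localEulerPoincareCharacteristic (v.adicCompletion K) :=
    fun K _ _ v ↦ X11b.LocBridge.localEulerPoincareCharacteristic_adicCompletionEP K v
  have hcd : fieldCdLE_two_of_numberField :=
    Literature.NumberTheory.GaloisRepresentations.fieldCdLE_two_of_numberField_holds
  have hBr : ∀ (K : Type) [Field K] [NumberField K] (p : ℕ) [Fact p.Prime],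
      ZpExtension.decomp_not_le_kerSubgroup_of_isAnticyclotomic K p :=
    fun K _ _ p _ ↦ ZpExtension.decomp_not_le_kerSubgroup_of_isAnticyclotomic_holds (K := K) (p := p)
  have hHP : ∀ (N : ℕ) [NeZero N] (W : WeierstrassCurve ℚ) (K : Type) [Field K] [NumberField K],
      heegnerPointComplex_mem_range_map N W K :=
    fun N _ W K _ _ ↦ heegnerPointComplex_mem_range_map_holds N W K
  have hEd : edixhoven_optimalManinConstant_integral :=
    ModularForms.edixhoven_optimalManinConstant_integral_holds
  unfold Summit.BirchSwinnertonDyer.BirchSwinnertonDyer.Theses.EisensteinPrimes.MazurMCOnCellB at hMCB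
  unfold Summit.BirchSwinnertonDyer.BirchSwinnertonDyer.Theses.EisensteinPrimes.BSDpOnCellC
  intro W _ _ p _ hc
  have hmod : hasEntireLFunction_rat := hasEntireLFunction_rat_of_exists_isNewformOf hnf
  have hp : p.Prime := Fact.out
  -- `p` is an odd prime: either `5 ≤ p` or `p = 3`
  have hp35 : 5 ≤ p ∨ p = 3 := by
    by_cases hp5 : 5 ≤ p
    · exact Or.inl hp5
    · right
      have hp2 : p ≠ 2 := hc.2.1
      have h2le := hp.two_le
      interval_cases p
      · exact absurd rfl hp2
      · rfl
      · exact absurd hp (by decide)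
  -- the Manin condition moved to the optimal curve, then sign × regime
  refine bsdp_of_cellC_of_forall_isIsogenous hEd hMaz hCassels hpar hnf hGZK W p hc ?_
  intro W₀ _ _ hiso hc₀ hMan₀
  by_cases hs : W.HasSplitMultiplicativeReductionAtPrime p
  · have hs₀ : W₀.HasSplitMultiplicativeReductionAtPrime p :=
      IsogenyQuotientLine.hasSplitMultiplicativeReductionAtPrime_of_isIsogenous hiso hs
    rcases hp35 with hp5 | hp3
    · exact bsdp_of_cellC_of_split_of_manin_of_pNewValue_of_imcIntOther W₀ p hGV hWu hJs hJn hHs hHn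
        hpar hGS hnf hPT hPT2 hEP hBr hH hCS hGZ hKo hHP hGZK hHL hp5 hc₀ hs₀ hMan₀ (h3s W₀ p hc₀ hs₀)
        (fun W' _ _ hB _ ↦ hMCB W' p hB)
    · exact bsdp_of_cellC_of_split_of_manin_of_intResidualsOther W₀ p hGV hWu hJs hJn hHs hHn hpar hGS
        hnf hPT hPT2 hEP hBr hH hGZ hKo hHP hGZK hHL hc₀ hs₀ hMan₀ (h2sthree W₀ p hp3 hc₀ hs₀)
        (h3s W₀ p hc₀ hs₀) (fun W' _ _ hB _ ↦ hMCB W' p hB)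
  · have hns₀ : ¬ W₀.HasSplitMultiplicativeReductionAtPrime p := fun h ↦
      hs (IsogenyQuotientLine.hasSplitMultiplicativeReductionAtPrime_of_isIsogenous
        hiso.symm_of_charZero h)
    rcases hp35 with hp5 | hp3
    · exact bsdp_of_cellC_of_not_split_of_manin_of_pNewValue_of_imcIntOther W₀ p hGV hWu hJs hJn hHs
        hHn hpar hGS hnf hPT hPT2 hEP hcd hBr hH hCS hGZ hKo hHP hGZK hHL hp5 hc₀ hns₀ hMan₀
        (h3n W₀ p hc₀ hns₀) (fun W' _ _ hB _ ↦ hMCB W' p hB)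
    · exact bsdp_of_cellC_of_not_split_of_manin_of_intResidualsOther W₀ p hGV hWu hJs hJn hHs hHn hpar
        hGS hnf hPT hPT2 hEP hcd hBr hH hGZ hKo hHP hGZK hHL hc₀ hns₀ hMan₀ (h2three W₀ p hp3 hc₀ hns₀)
        (h3n W₀ p hc₀ hns₀) (fun W' _ _ hB _ ↦ hMCB W' p hB)

end Composition

end Summit.BirchSwinnertonDyer.BirchSwinnertonDyer.Theorems.Reoriented

end
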